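import Literature.Combinatorics.Optimization.HexagonComplexPsdRank
import HarnessLib

/-!
# The psd rank of the inner product matrix `IP_n` is `Θ(√N)` (Lee–Wei–de Wolf 2017, §6.3:
# Theorem 50, Theorem 51; tightness via Fact 4) — PROVED

Source: T. Lee, Z. Wei, R. de Wolf, *Some upper and lower bounds on PSD-rank*, Math. Program. 162
(2017) 495–521 = arXiv:1407.4308 [LeeWeiDeWolf2017]; held text `paper:arxiv-1407.4308`, p14–p15
(`pNN` = held-text chunk).

Printed statements (p14, verbatim). "Let `x, y ∈ {0,1}ⁿ` be two `n`-bit strings. The inner product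
function is defined as `IP(x,y) = Σ_{i=1}^n x_i y_i mod 2`. We denote the corresponding `N`-by-`N` matrix
by `IP_n`, where `N = 2ⁿ`." "**Theorem 50.** `rank_psd(IP_n) ≤ 2√N`." (one-way quantum protocol with
`n/2 + 1` qubits computing `IP_n` in expectation.) "**Theorem 51.** `rank_psd^ℝ(IP_n) ≤ c√N`. If `n` is
even, `c = 2`, and if `n` is odd, `c = (3/2)√2`." Printed proof of Theorem 51 (p14–p15):
"`IP_{k+1} = [IP_k, IP_k; IP_k, J_k − IP_k]` … `IP_n` can be expressed as a block matrix with each block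
being `IP_k` or `J − IP_k` … a new block matrix `M_n` … The blocks in the first block row of `M_n` are
the same as `IP_n` … In the rest of the block rows, if a block of `IP_n` is `IP_k`, then we choose the
corresponding block of `M_n` to be `−IP_k`, and if a block of `IP_n` is `J_k − IP_k`, the corresponding
block of `M_n` is also `J_k − IP_k`. … `M_n ∘ M̄_n = IP_n`, and since `M_n` is real, we have that
`rank_psd^ℝ(IP_n) ≤ rank(M_n)` … we add its first block row to the other block rows …
`rank_psd^ℝ(IP_n) ≤ rank(M_n) = rank(M'_n) ≤ 2^k − 1 + N/2^k` … If `n` is even, we choose `k = n/2` …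
`≤ 2√N − 1`. If `n` is odd, we choose `k = (n+1)/2` … `≤ ((3/2)√2)√N − 1`."

## Contents (all PROVED; no named facts)

* `ipBool x y` (`Σ_i x_i y_i mod 2` as a `Bool`), `ipMatrix ι` (the `0/1` matrix `IP` on `{0,1}^ι`);
  `ipBool_sum` — the block structure `IP(x₀x₁, y₀y₁) = IP(x₀,y₀) ⊕ IP(x₁,y₁)` behind
  "`IP_{k+1} = [IP_k, IP_k; IP_k, J − IP_k]`".
* `lwdwIpRoot` — the printed real Hadamard square root `M_n` in closed form
  `M(x₀x₁, y₀y₁) = u(x₀)·IP(x₁,y₁) + IP(x₀,y₀)`, `u(0) = 1`, `u(x₀) = −1` (`x₀ ≠ 0`); `lwdwIpRoot_sq`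
  (`M ∘ M = IP`); `lwdwIpRoot_eq_sum` — the printed row reduction as an explicit factorization of `M`
  through `(2^k − 1) + (2^{n−k} − 1)` terms (both `IP_k` and `IP_{n−k}` have a zero row; the print keeps
  `N/2^k` for the second summand).
* **`LeeWeiDeWolf2017_thm51_split`**: `rank_psd^ℝ(IP_{p+q}) ≤ (2^q − 1) + (2^p − 1)` (FGPRT Thm. 2.9 (v),
  `HasPsdFactorization.hadamardSq`); **`LeeWeiDeWolf2017_thm51`** (the printed `c√N` form, with the
  printed constants); **`LeeWeiDeWolf2017_thm50_even`** (complex psd rank `≤ 2√N` for even `n`, from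
  Theorem 51 via `HasPsdFactorization.toComplex`; the printed quantum-protocol proof splits `x` into two
  `n/2`-bit halves, i.e. takes `n` even — for odd `n` we record the real bound `(3/√2)√N` instead).
* Tightness ("These bounds are tight up to constant factors", p12, via Fact 4 `B₁ = √rank`, p05):
  `ipSign` (`H = (−1)^{IP}`, the Sylvester–Hadamard matrix), `sum_ipSign_mul` / `ipSign_mul_transpose`
  (`HHᵀ = N·I`), `rank_ipSign` (`= N`), **`rank_ipMatrix`** (`rank IP_n = N − 1`: `H = J − 2·IP` and the
  zero row), `LeeWeiDeWolf2017_ip_lower_complex` (`N − 1 ≤ r²`), `LeeWeiDeWolf2017_ip_lower_real`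
  (`N − 1 ≤ C(r+1,2)`, FGPRT Prop. 2.5).
-/

noncomputable section

open Matrix Finset

namespace Literature.Combinatorics.Optimization

section InnerProduct

variable {ι : Type*} [Fintype ι]

/-- The inner product function `IP(x,y) = Σ_i x_i y_i mod 2` on `{0,1}^ι`, as a Boolean.
[cite: LeeWeiDeWolf2017, §6.3 (p14)] -/
def ipBool (x y : ι → Bool) : Bool := (∑ i, (x i && y i).toNat).bodd

/-- **The inner product matrix `IP_n`** (`N × N`, `N = 2ⁿ`, entries `IP(x,y) ∈ {0,1}`), here on `{0,1}^ι`.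
[cite: LeeWeiDeWolf2017, §6.3 (p14)] -/
def ipMatrix (ι : Type*) [Fintype ι] : (ι → Bool) → (ι → Bool) → ℝ :=
  fun x y => if ipBool x y then 1 else 0

omit [Fintype ι] in
/-- `IP(0, y) = 0` (the zero row of `IP_k`, whence "`2^k − 1` comes from the rank of `IP_k`").
[cite: LeeWeiDeWolf2017, Thm. 51 proof (p15)] -/
theorem ipBool_zero_left [Fintype ι] (y : ι → Bool) : ipBool (fun _ => false) y = false := by
  simp [ipBool]

/-- `IP` is invariant under relabelling the coordinates. [cite: LeeWeiDeWolf2017, §6.3 (p14)] -/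
theorem ipBool_comp_equiv {ι' : Type*} [Fintype ι'] (e : ι' ≃ ι) (x y : ι → Bool) :
    ipBool (x ∘ e) (y ∘ e) = ipBool x y := by
  unfold ipBool
  rw [show (∑ i, (((x ∘ e) i) && ((y ∘ e) i)).toNat) = ∑ i, (x i && y i).toNat from
    e.sum_comp (fun i => (x i && y i).toNat)]

/-- `IP_n` is invariant under relabelling the coordinates. [cite: LeeWeiDeWolf2017, §6.3 (p14)] -/
theorem ipMatrix_comp_equiv {ι' : Type*} [Fintype ι'] (e : ι' ≃ ι) (x y : ι → Bool) :
    ipMatrix ι' (x ∘ e) (y ∘ e) = ipMatrix ι x y := by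
  simp only [ipMatrix, ipBool_comp_equiv]

/-- **The block structure of `IP`**: splitting the coordinates, `IP(x₀x₁, y₀y₁) = IP(x₀,y₀) ⊕ IP(x₁,y₁)`
("`IP_{k+1} = [IP_k, IP_k; IP_k, J_k − IP_k]` … each block being `IP_k` or `J − IP_k`").
[cite: LeeWeiDeWolf2017, Thm. 51 proof (p14–p15)] -/
theorem ipBool_sum {α β : Type*} [Fintype α] [Fintype β] (x y : α ⊕ β → Bool) :
    ipBool x y = xor (ipBool (x ∘ Sum.inl) (y ∘ Sum.inl)) (ipBool (x ∘ Sum.inr) (y ∘ Sum.inr)) := by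
  simp only [ipBool, Fintype.sum_sum_type, Function.comp_apply, Nat.bodd_add]

/-- **The real Hadamard square root `M_n` of `IP_n`** (first block row `IP_k`; below it `−IP_k` where
`IP_n` has `IP_k` and `J − IP_k` where `IP_n` has `J − IP_k`), in closed form
`M(x₀x₁, y₀y₁) = u(x₀)·IP(x₁,y₁) + IP(x₀,y₀)` with `u(0) = 1`, `u(x₀) = −1` otherwise.
[cite: LeeWeiDeWolf2017, Thm. 51 proof (p15, the matrix M_n)] -/
def lwdwIpRoot {α β : Type*} [Fintype α] [Fintype β] (x y : α ⊕ β → Bool) : ℝ :=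
  (if x ∘ Sum.inl = fun _ => false then 1 else -1) * ipMatrix β (x ∘ Sum.inr) (y ∘ Sum.inr) +
    ipMatrix α (x ∘ Sum.inl) (y ∘ Sum.inl)

/-- **`M_n ∘ M̄_n = IP_n`** (`M_n` real with entries in `{0, ±1}` squaring to `IP_n`).
[cite: LeeWeiDeWolf2017, Thm. 51 proof (p15)] -/
theorem lwdwIpRoot_sq {α β : Type*} [Fintype α] [Fintype β] (x y : α ⊕ β → Bool) :
    lwdwIpRoot x y ^ 2 = ipMatrix (α ⊕ β) x y := by
  simp only [lwdwIpRoot, ipMatrix, ipBool_sum]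
  by_cases h0 : x ∘ Sum.inl = fun _ => false
  · rw [if_pos h0, h0, ipBool_zero_left]
    cases ipBool (x ∘ Sum.inr) (y ∘ Sum.inr) <;> norm_num
  · rw [if_neg h0]
    cases ipBool (x ∘ Sum.inl) (y ∘ Sum.inl) <;> cases ipBool (x ∘ Sum.inr) (y ∘ Sum.inr) <;> norm_num

/-- The index set of the factorization of `M_n`: the nonzero rows of `IP_k` and of `IP_{n−k}`.
[cite: LeeWeiDeWolf2017, Thm. 51 proof (p15, "2^k − 1 comes from the rank of IP_k, and N/2^k comes from
the number of blocks")] -/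
abbrev LwdwIpIdx (α β : Type*) : Type _ :=
  {z : β → Bool // z ≠ fun _ => false} ⊕ {w : α → Bool // w ≠ fun _ => false}

/-- `#{z ∈ {0,1}^γ : z ≠ 0} = 2^{|γ|} − 1`. [folklore] -/
private theorem card_ne_zero_fun (γ : Type*) [Fintype γ] [DecidableEq γ] :
    Fintype.card {z : γ → Bool // z ≠ fun _ => false} = 2 ^ Fintype.card γ - 1 := by
  rw [Fintype.card_subtype_compl, Fintype.card_subtype_eq, Fintype.card_fun, Fintype.card_bool]

/-- Its cardinality `(2^k − 1) + (2^{n−k} − 1)`. [cite: LeeWeiDeWolf2017, Thm. 51 proof (p15)] -/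
theorem card_lwdwIpIdx (α β : Type*) [Fintype α] [Fintype β] [DecidableEq α] [DecidableEq β] :
    Fintype.card (LwdwIpIdx α β) = (2 ^ Fintype.card β - 1) + (2 ^ Fintype.card α - 1) := by
  rw [Fintype.card_sum, card_ne_zero_fun, card_ne_zero_fun]

/-- The left factors: `a(x, z) = u(x₀)·[x₁ = z]` (`z ≠ 0`), `a(x, w) = [x₀ = w]` (`w ≠ 0`).
[cite: LeeWeiDeWolf2017, Thm. 51 proof (p15, the row reduction M_n ↦ M'_n)] -/
def lwdwIpA {α β : Type*} [Fintype α] [Fintype β] [DecidableEq α] [DecidableEq β]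
    (x : α ⊕ β → Bool) : LwdwIpIdx α β → ℝ
  | Sum.inl z => (if x ∘ Sum.inl = fun _ => false then 1 else -1) * (if x ∘ Sum.inr = z.1 then 1 else 0)
  | Sum.inr w => if x ∘ Sum.inl = w.1 then 1 else 0

/-- The right factors: `b(y, z) = IP(z, y₁)`, `b(y, w) = IP(w, y₀)`.
[cite: LeeWeiDeWolf2017, Thm. 51 proof (p15)] -/
def lwdwIpB {α β : Type*} [Fintype α] [Fintype β] (y : α ⊕ β → Bool) : LwdwIpIdx α β → ℝ
  | Sum.inl z => ipMatrix β z.1 (y ∘ Sum.inr)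
  | Sum.inr w => ipMatrix α w.1 (y ∘ Sum.inl)

/-- **The row reduction as a factorization**: `M(x,y) = Σ_{z ≠ 0} u(x₀)[x₁ = z] IP(z,y₁) +
Σ_{w ≠ 0} [x₀ = w] IP(w,y₀)`, i.e. `rank M_n ≤ (2^k − 1) + (2^{n−k} − 1)` ("the rank of `M'_n` can be
upper bounded by the sum of the rank of the first block row and that of the remaining block rows").
[cite: LeeWeiDeWolf2017, Thm. 51 proof (p15)] -/
theorem lwdwIpRoot_eq_sum {α β : Type*} [Fintype α] [Fintype β] [DecidableEq α] [DecidableEq β]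
    (x y : α ⊕ β → Bool) : lwdwIpRoot x y = ∑ s, lwdwIpA x s * lwdwIpB y s := by
  rw [Fintype.sum_sum_type]
  simp only [lwdwIpA, lwdwIpB]
  -- first summand: the `IP_k` part
  have h1 : ∑ z : {z : β → Bool // z ≠ fun _ => false},
      (if x ∘ Sum.inl = fun _ => false then (1 : ℝ) else -1) * (if x ∘ Sum.inr = z.1 then 1 else 0) *
        ipMatrix β z.1 (y ∘ Sum.inr) =
      (if x ∘ Sum.inl = fun _ => false then (1 : ℝ) else -1) * ipMatrix β (x ∘ Sum.inr) (y ∘ Sum.inr) := by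
    by_cases hx : x ∘ Sum.inr = fun _ => false
    · rw [hx, ipMatrix, ipBool_zero_left]
      simp only [Bool.false_eq_true, if_false, mul_zero]
      refine Finset.sum_eq_zero fun z _ => ?_
      rw [if_neg (Ne.symm z.2), mul_zero, zero_mul]
    · rw [Finset.sum_eq_single ⟨x ∘ Sum.inr, hx⟩]
      · simp
      · intro z _ hz
        have hne : ¬ (x ∘ Sum.inr = z.1) := fun h => hz (Subtype.ext h).symm
        simp [hne]
      · intro h; exact absurd (Finset.mem_univ _) h
  -- second summand: the `IP_{n−k}` part
  have h2 : ∑ w : {w : α → Bool // w ≠ fun _ => false},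
      (if x ∘ Sum.inl = w.1 then (1 : ℝ) else 0) * ipMatrix α w.1 (y ∘ Sum.inl) =
      ipMatrix α (x ∘ Sum.inl) (y ∘ Sum.inl) := by
    by_cases hx : x ∘ Sum.inl = fun _ => false
    · rw [hx, ipMatrix, ipBool_zero_left]
      simp only [Bool.false_eq_true, if_false]
      refine Finset.sum_eq_zero fun w _ => ?_
      rw [if_neg (Ne.symm w.2), zero_mul]
    · rw [Finset.sum_eq_single ⟨x ∘ Sum.inl, hx⟩]
      · simp
      · intro w _ hw
        have hne : ¬ (x ∘ Sum.inl = w.1) := fun h => hw (Subtype.ext h).symm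
        simp [hne]
      · intro h; exact absurd (Finset.mem_univ _) h
  rw [h1, h2, lwdwIpRoot]

/-- **LWdW Theorem 51, split form**: `IP` on `{0,1}^{α ⊔ β}` has a REAL psd factorization of size
`(2^{|β|} − 1) + (2^{|α|} − 1)` (rank-one factors: FGPRT Thm. 2.9 (v) applied to `M_n`).
[cite: LeeWeiDeWolf2017, Thm. 51 (p14–p15)] -/
theorem hasPsdFactorization_ipMatrix_sum (α β : Type*) [Fintype α] [Fintype β] [DecidableEq α]
    [DecidableEq β] :
    HasPsdFactorization (ipMatrix (α ⊕ β)) ((2 ^ Fintype.card β - 1) + (2 ^ Fintype.card α - 1)) := by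
  classical
  let e : Fin ((2 ^ Fintype.card β - 1) + (2 ^ Fintype.card α - 1)) ≃ LwdwIpIdx α β :=
    (Fintype.equivFinOfCardEq (card_lwdwIpIdx α β)).symm
  have hfac : ∀ x y : α ⊕ β → Bool, lwdwIpRoot x y = ∑ l, lwdwIpA x (e l) * lwdwIpB y (e l) := by
    intro x y
    rw [lwdwIpRoot_eq_sum, ← e.sum_comp (fun s => lwdwIpA x s * lwdwIpB y s)]
  have h := HasPsdFactorization.hadamardSq (M := lwdwIpRoot) (fun x l => lwdwIpA x (e l))
    (fun y l => lwdwIpB y (e l)) hfac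
  have heq : (fun x y : α ⊕ β → Bool => lwdwIpRoot x y ^ 2) = ipMatrix (α ⊕ β) := by
    funext x y; exact lwdwIpRoot_sq x y
  rw [heq] at h
  exact h

/-- **LWdW Theorem 51, with `k` free** ("`rank_psd^ℝ(IP_n) ≤ rank(M'_n) ≤ 2^k − 1 + N/2^k`"; here
`n = p + q`, `k = q`, and the second summand sharpened to `2^p − 1`):
`rank_psd^ℝ(IP_{p+q}) ≤ (2^q − 1) + (2^p − 1)`. [cite: LeeWeiDeWolf2017, Thm. 51 proof (p15)] -/
theorem LeeWeiDeWolf2017_thm51_split (p q : ℕ) :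
    HasPsdFactorization (ipMatrix (Fin (p + q))) ((2 ^ q - 1) + (2 ^ p - 1)) := by
  have h := hasPsdFactorization_ipMatrix_sum (Fin p) (Fin q)
  simp only [Fintype.card_fin] at h
  have h' := h.submatrix (fun x : Fin (p + q) → Bool => x ∘ finSumFinEquiv)
    (fun y : Fin (p + q) → Bool => y ∘ finSumFinEquiv)
  have heq : (fun x y : Fin (p + q) → Bool =>
      ipMatrix (Fin p ⊕ Fin q) (x ∘ finSumFinEquiv) (y ∘ finSumFinEquiv)) = ipMatrix (Fin (p + q)) := by
    funext x y; exact ipMatrix_comp_equiv _ x y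
  rw [heq] at h'
  exact h'

/-- `√(2^{2m}) = 2^m`. [folklore] -/
private theorem sqrt_two_pow_two_mul (m : ℕ) : Real.sqrt ((2 : ℝ) ^ (m + m)) = 2 ^ m := by
  rw [pow_add, Real.sqrt_mul_self (by positivity)]

/-- `√(2^{2m+1}) = 2^m √2`. [folklore] -/
private theorem sqrt_two_pow_two_mul_add_one (m : ℕ) :
    Real.sqrt ((2 : ℝ) ^ (m + m + 1)) = 2 ^ m * Real.sqrt 2 := by
  rw [pow_succ, Real.sqrt_mul (by positivity), sqrt_two_pow_two_mul]

/-- **LWdW Theorem 51, even `n`**: `rank_psd^ℝ(IP_n) ≤ 2√N − 2` (`k = n/2`; printed `≤ 2√N − 1`).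
[cite: LeeWeiDeWolf2017, Thm. 51 (p14–p15)] -/
theorem LeeWeiDeWolf2017_thm51_even {n : ℕ} (hn : Even n) :
    ∃ r : ℕ, HasPsdFactorization (ipMatrix (Fin n)) r ∧ (r : ℝ) ≤ 2 * Real.sqrt (2 ^ n) - 2 := by
  obtain ⟨m, rfl⟩ := hn
  refine ⟨_, LeeWeiDeWolf2017_thm51_split m m, ?_⟩
  have h1 : 1 ≤ 2 ^ m := Nat.one_le_two_pow
  rw [sqrt_two_pow_two_mul]
  push_cast [Nat.cast_sub h1]
  linarith

/-- **LWdW Theorem 51, odd `n`**: `rank_psd^ℝ(IP_n) ≤ (3/2)√2·√N − 2` (`k = (n+1)/2`; printed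
`≤ ((3/2)√2)√N − 1`). [cite: LeeWeiDeWolf2017, Thm. 51 (p14–p15)] -/
theorem LeeWeiDeWolf2017_thm51_odd {n : ℕ} (hn : Odd n) :
    ∃ r : ℕ, HasPsdFactorization (ipMatrix (Fin n)) r ∧
      (r : ℝ) ≤ 3 / 2 * Real.sqrt 2 * Real.sqrt (2 ^ n) - 2 := by
  obtain ⟨m, rfl⟩ := hn
  rw [show 2 * m + 1 = m + (m + 1) by ring]
  refine ⟨_, LeeWeiDeWolf2017_thm51_split m (m + 1), ?_⟩
  have h1 : 1 ≤ 2 ^ m := Nat.one_le_two_pow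
  have h2 : 1 ≤ 2 ^ (m + 1) := Nat.one_le_two_pow
  rw [show m + (m + 1) = m + m + 1 by ring, sqrt_two_pow_two_mul_add_one]
  have hs : Real.sqrt 2 * Real.sqrt 2 = 2 := Real.mul_self_sqrt (by norm_num)
  have h3 : (3 : ℝ) / 2 * Real.sqrt 2 * (2 ^ m * Real.sqrt 2) - 2 = 3 * 2 ^ m - 2 := by
    linear_combination ((3 : ℝ) / 2 * 2 ^ m) * hs
  rw [h3]
  push_cast [Nat.cast_sub h1, Nat.cast_sub h2]
  rw [pow_succ]
  linarith

/-- **LWdW Theorem 51** (p14, verbatim: "`rank_psd^ℝ(IP_n) ≤ c√N`. If `n` is even, `c = 2`, and if `n` is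
odd, `c = (3/2)√2`"), `N = 2ⁿ`: the inner product matrix has a real psd factorization of size
`≤ c√N`. [cite: LeeWeiDeWolf2017, Thm. 51 (p14–p15)] -/
theorem LeeWeiDeWolf2017_thm51 (n : ℕ) :
    ∃ r : ℕ, HasPsdFactorization (ipMatrix (Fin n)) r ∧
      (r : ℝ) ≤ (if Even n then 2 else 3 / 2 * Real.sqrt 2) * Real.sqrt (2 ^ n) := by
  rcases Nat.even_or_odd n with hn | hn
  · obtain ⟨r, hr, hle⟩ := LeeWeiDeWolf2017_thm51_even hn
    exact ⟨r, hr, by rw [if_pos hn]; linarith⟩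
  · obtain ⟨r, hr, hle⟩ := LeeWeiDeWolf2017_thm51_odd hn
    exact ⟨r, hr, by rw [if_neg (Nat.not_even_iff_odd.mpr hn)]; linarith⟩

/-- **LWdW Theorem 50** (p14, verbatim: "`rank_psd(IP_n) ≤ 2√N`"), for even `n` (the printed one-way
quantum protocol sends `1 + n/2` qubits, splitting `x = x₀x₁` into two `n/2`-bit halves): the COMPLEX
psd rank of `IP_n` is at most `2√N` — here from Theorem 51's real factorization (`rank_psd ≤ rank_psd^ℝ`,
`HasPsdFactorization.toComplex`); for odd `n` Theorem 51 gives `(3/√2)√N` (`LeeWeiDeWolf2017_thm51_odd`).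
[cite: LeeWeiDeWolf2017, Thm. 50 (p14)] -/
theorem LeeWeiDeWolf2017_thm50_even {n : ℕ} (hn : Even n) :
    ∃ r : ℕ, HasComplexPsdFactorization (ipMatrix (Fin n)) r ∧ (r : ℝ) ≤ 2 * Real.sqrt (2 ^ n) := by
  obtain ⟨r, hr, hle⟩ := LeeWeiDeWolf2017_thm51_even hn
  exact ⟨r, hr.toComplex, by linarith⟩

/-! ### Tightness: `rank IP_n = N − 1`, hence `rank_psd(IP_n) ≥ √(N − 1)` -/

/-- `(−1)^s` by parity. [folklore] -/
private theorem neg_one_pow_eq_bodd (s : ℕ) : (-1 : ℝ) ^ s = if s.bodd then -1 else 1 := by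
  induction s with
  | zero => simp
  | succ k ih =>
    rw [pow_succ, ih, Nat.bodd_succ]
    cases k.bodd <;> simp

/-- The `±1` (Sylvester–Hadamard) form of the inner product matrix, `H(x,y) = (−1)^{IP(x,y)}`.
[cite: LeeWeiDeWolf2017, §6.3 (p14)] -/
def ipSign (x y : ι → Bool) : ℝ := if ipBool x y then -1 else 1

/-- `(−1)^{IP(x,y)} = ∏_i (−1)^{x_i y_i}`. [cite: LeeWeiDeWolf2017, §6.3 (p14, "IP(x,y) = Σ x_i y_i mod 2")] -/
theorem ipSign_eq_prod (x y : ι → Bool) :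
    ipSign x y = ∏ i, (if (x i && y i) then (-1 : ℝ) else 1) := by
  have h : ipSign x y = (-1 : ℝ) ^ (∑ i, (x i && y i).toNat) := by
    rw [neg_one_pow_eq_bodd]; rfl
  rw [h, ← Finset.prod_pow_eq_pow_sum]
  refine Finset.prod_congr rfl fun i _ => ?_
  cases (x i && y i) <;> simp

/-- **Orthogonality of the rows of `H`**: `Σ_y (−1)^{IP(x,y)} (−1)^{IP(x',y)} = N [x = x']` (the
characters of `(ℤ/2)ⁿ`). [cite: LeeWeiDeWolf2017, §6.3 (p14)] -/
theorem sum_ipSign_mul [DecidableEq ι] (x x' : ι → Bool) :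
    ∑ y : ι → Bool, ipSign x y * ipSign x' y = if x = x' then (2 : ℝ) ^ Fintype.card ι else 0 := by
  classical
  have h : ∀ y : ι → Bool, ipSign x y * ipSign x' y =
      ∏ i, ((if (x i && y i) then (-1 : ℝ) else 1) * (if (x' i && y i) then (-1 : ℝ) else 1)) := by
    intro y; rw [ipSign_eq_prod, ipSign_eq_prod, ← Finset.prod_mul_distrib]
  simp_rw [h]
  have hps := Finset.prod_univ_sum (fun _ : ι => (Finset.univ : Finset Bool))
    (fun i (b : Bool) => (if (x i && b) then (-1 : ℝ) else 1) * (if (x' i && b) then (-1 : ℝ) else 1))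
  rw [Fintype.piFinset_univ] at hps
  rw [← hps]
  have hf : ∀ i, ∑ b : Bool, (if (x i && b) then (-1 : ℝ) else 1) * (if (x' i && b) then (-1 : ℝ) else 1) =
      if x i = x' i then 2 else 0 := by
    intro i
    rw [Fintype.sum_bool]
    cases x i <;> cases x' i <;> norm_num
  simp_rw [hf]
  by_cases hxx : x = x'
  · subst hxx
    simp [Finset.prod_const, Finset.card_univ]
  · rw [if_neg hxx]
    obtain ⟨i, hi⟩ := Function.ne_iff.mp hxx
    exact Finset.prod_eq_zero (Finset.mem_univ i) (if_neg hi)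

/-- `H Hᵀ = N·I`. [cite: LeeWeiDeWolf2017, §6.3 (p14)] -/
theorem ipSign_mul_transpose [DecidableEq ι] :
    (Matrix.of (ipSign (ι := ι))) * (Matrix.of (ipSign (ι := ι)))ᵀ =
      ((2 : ℝ) ^ Fintype.card ι) • (1 : Matrix (ι → Bool) (ι → Bool) ℝ) := by
  ext x x'
  rw [Matrix.mul_apply]
  simp only [Matrix.transpose_apply, Matrix.of_apply, Matrix.smul_apply, Matrix.one_apply, smul_eq_mul,
    mul_ite, mul_one, mul_zero]
  exact sum_ipSign_mul x x'

/-- `rank H = N`. [cite: LeeWeiDeWolf2017, §6.3 (p14)] -/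
theorem rank_ipSign [DecidableEq ι] : (Matrix.of (ipSign (ι := ι))).rank = 2 ^ Fintype.card ι := by
  classical
  set S : Matrix (ι → Bool) (ι → Bool) ℝ := Matrix.of (ipSign (ι := ι)) with hSdef
  have hc : ((2 : ℝ) ^ Fintype.card ι) ≠ 0 := by positivity
  have hinv : S * ((((2 : ℝ) ^ Fintype.card ι)⁻¹) • Sᵀ) = 1 := by
    rw [Matrix.mul_smul, hSdef, ipSign_mul_transpose, smul_smul, inv_mul_cancel₀ hc, one_smul]
  haveI : Invertible S := invertibleOfRightInverse _ _ hinv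
  rw [Matrix.rank_of_isUnit S (isUnit_of_invertible S), Fintype.card_fun, Fintype.card_bool]

/-- `IP = (J − H)/2` entrywise. [cite: LeeWeiDeWolf2017, §6.3 (p14)] -/
theorem ipMatrix_eq_ipSign (x y : ι → Bool) : ipMatrix ι x y = (1 - ipSign x y) / 2 := by
  simp only [ipMatrix, ipSign]
  cases ipBool x y <;> norm_num

/-- Subadditivity of `Matrix.rank` (over a field). [folklore] -/
private theorem rank_add_le_aux {m k : Type*} [Fintype m] [Fintype k] (A B : Matrix m k ℝ) :
    (A + B).rank ≤ A.rank + B.rank := by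
  unfold Matrix.rank
  rw [Matrix.mulVecLin_add]
  calc Module.finrank ℝ (LinearMap.range (A.mulVecLin + B.mulVecLin))
      ≤ Module.finrank ℝ ↥(LinearMap.range A.mulVecLin ⊔ LinearMap.range B.mulVecLin) := by
        apply Submodule.finrank_mono
        rintro _ ⟨v, rfl⟩
        exact Submodule.add_mem_sup ⟨v, rfl⟩ ⟨v, rfl⟩
    _ ≤ _ := Submodule.finrank_add_le_finrank_add_finrank _ _

/-- **`rank IP_n = N − 1`** (`H = J − 2·IP` has rank `N`, `J` rank `1`; and `IP` has the zero row
`x = 0`), the input of Fact 4 (`B₁ = √rank`) behind "These bounds are tight up to constant factors".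
[cite: LeeWeiDeWolf2017, §6 (p12, "tight up to constant factors") and Fact 4 (p05)] -/
theorem rank_ipMatrix (ι : Type*) [Fintype ι] [DecidableEq ι] :
    (Matrix.of (ipMatrix ι)).rank = 2 ^ Fintype.card ι - 1 := by
  classical
  set P : Matrix (ι → Bool) (ι → Bool) ℝ := Matrix.of (ipMatrix ι) with hPdef
  set S : Matrix (ι → Bool) (ι → Bool) ℝ := Matrix.of (ipSign (ι := ι)) with hSdef
  set J : Matrix (ι → Bool) (ι → Bool) ℝ := Matrix.of fun _ _ => (1 : ℝ) with hJdef
  apply le_antisymm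
  · -- `≤`: the row `x = 0` vanishes
    let E : Matrix (ι → Bool) {z : ι → Bool // z ≠ fun _ => false} ℝ :=
      Matrix.of fun x z => if x = z.1 then 1 else 0
    let P₀ : Matrix {z : ι → Bool // z ≠ fun _ => false} (ι → Bool) ℝ :=
      Matrix.of fun z y => ipMatrix ι z.1 y
    have hP : P = E * P₀ := by
      ext x y
      rw [Matrix.mul_apply]
      by_cases hx : x = fun _ => false
      · have h0 : P x y = 0 := by
          rw [hPdef, Matrix.of_apply, hx, ipMatrix, ipBool_zero_left]; rfl
        rw [h0]
        symm
        refine Finset.sum_eq_zero fun z _ => ?_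
        have hne : ¬ (x = z.1) := fun h => z.2 (h ▸ hx)
        simp [E, hne]
      · rw [Finset.sum_eq_single ⟨x, hx⟩]
        · simp [E, P₀, hPdef]
        · intro z _ hz
          have hne : ¬ (x = z.1) := fun h => hz (Subtype.ext h).symm
          simp [E, hne]
        · intro h; exact absurd (Finset.mem_univ _) h
    calc P.rank = (E * P₀).rank := by rw [hP]
      _ ≤ P₀.rank := Matrix.rank_mul_le_right _ _
      _ ≤ Fintype.card {z : ι → Bool // z ≠ fun _ => false} := Matrix.rank_le_card_height _
      _ = 2 ^ Fintype.card ι - 1 := card_ne_zero_fun ι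
  · -- `≥`: `S = J − 2P` has full rank
    have hS : S = J + P * ((-2 : ℝ) • (1 : Matrix (ι → Bool) (ι → Bool) ℝ)) := by
      ext x y
      rw [Matrix.add_apply, Matrix.mul_smul, Matrix.mul_one, Matrix.smul_apply, hSdef, hJdef, hPdef,
        Matrix.of_apply, Matrix.of_apply, Matrix.of_apply, ipMatrix_eq_ipSign, smul_eq_mul]
      ring
    have h1 : S.rank ≤ J.rank + (P * ((-2 : ℝ) • (1 : Matrix (ι → Bool) (ι → Bool) ℝ))).rank := by
      rw [hS]; exact rank_add_le_aux _ _
    have hJ : J.rank ≤ 1 := by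
      have : J = Matrix.vecMulVec (fun _ => (1 : ℝ)) (fun _ => (1 : ℝ)) := by
        ext x y; simp [hJdef, Matrix.vecMulVec_apply]
      rw [this]; exact Matrix.rank_vecMulVec_le _ _
    have hP2 : (P * ((-2 : ℝ) • (1 : Matrix (ι → Bool) (ι → Bool) ℝ))).rank ≤ P.rank :=
      Matrix.rank_mul_le_left _ _
    rw [hSdef, rank_ipSign] at h1
    omega

/-- **Tightness of Theorems 50/51, complex** ("These bounds are tight up to constant factors": by
Fact 4, `rank_psd(IP_n) ≥ √rank(IP_n) = √(N − 1)`): every complex psd factorization of `IP_n` has size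
`r` with `N − 1 ≤ r²`. [cite: LeeWeiDeWolf2017, §6 (p12) with Fact 4 (p05)] -/
theorem LeeWeiDeWolf2017_ip_lower_complex {n r : ℕ} (h : HasComplexPsdFactorization (ipMatrix (Fin n)) r) :
    2 ^ n - 1 ≤ r ^ 2 := by
  have h1 := h.rank_le_sq
  have h2 := rank_ipMatrix (Fin n)
  rw [Fintype.card_fin] at h2
  change (Matrix.of (ipMatrix (Fin n))).rank ≤ r ^ 2 at h1
  omega

/-- **Tightness of Theorem 51, real** (Fact 4 for real factors, FGPRT Prop. 2.5: `rank ≤ C(r+1, 2)`):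
every real psd factorization of `IP_n` has size `r` with `N − 1 ≤ r(r+1)/2`, i.e. `r ≳ √2·√N`.
[cite: LeeWeiDeWolf2017, §6 (p12) with Fact 4 (p05)] -/
theorem LeeWeiDeWolf2017_ip_lower_real {n r : ℕ} (h : HasPsdFactorization (ipMatrix (Fin n)) r) :
    2 ^ n - 1 ≤ (r + 1).choose 2 := by
  have h1 := FawziEtAl2015_prop25_rank_holds _ _ (Matrix.of (ipMatrix (Fin n))) r h
  have h2 := rank_ipMatrix (Fin n)
  rw [Fintype.card_fin] at h2
  omega

end InnerProduct

end Literature.Combinatorics.Optimization
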